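import Summits.RiemannHypothesis.RiemannHypothesis.Theorems.WeilTwoPrimeDeflM80XBase
import Summits.RiemannHypothesis.RiemannHypothesis.Theorems.WeilTwoPrimeDeflM80PDataR
import Literature.NumberTheory.LFunctions.WeilTwoPrimeCellsT80
import Summits.RiemannHypothesis.RiemannHypothesis.Theorems.GroundBartaEvenWinsBeyondArchPhantomXT80M4Cells
import Summits.RiemannHypothesis.RiemannHypothesis.Theorems.GroundBartaEvenWinsBeyondArchPhantomCertificate
import Literature.NumberTheory.LFunctions.WeilTwoPrimeCertificateDeflated
import HarnessLib

/-!
# Calibration certificate M80X: the certificate `weilCertDeflM80X : WeilCert23X` and its augmented coefficient matrix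

`weilCertDeflM80X` = base `weilCertDeflM80XBase` + `j = 5` + `pnu = 64` + the T80 cells + support `b = 4023/5000` + the table `weilCertDeflM80XNu` + boosted level `529/250` + phantom cells `xt80m4Cells` + ripples `xt80m4Rs`; penalty data `weilCertDeflM80PR` (M80P's, by name); `weilCertDeflM80XP = P_r + Σ μ ĉ ĉᵀ`. [cite: Yoshida1992, §6, Thm 1 p. 310] Data only.
-/

set_option linter.dupNamespace false

noncomputable section

namespace Summit.RiemannHypothesis.RiemannHypothesis.Theorems.EvenWinsBeyondArch

open Literature.NumberTheory.LFunctions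

/-- **The calibration certificate M80X** (`a₀ = b = 4023/5000`, `N = 177`, `T = 80`, `wL' = 529/250`, `β₂₃ = 17/25`, k_even = 6 penalties of M80P). [folklore] -/
def weilCertDeflM80X : WeilCert23X := ⟨weilCertDeflM80XBase, 5, 64, weilTwoPrimeCellsT80, 4023/5000, weilCertDeflM80XNu, 529/250, xt80m4Cells, xt80m4Rs⟩

/-- The base of `weilCertDeflM80X` is `weilCertDeflM80XBase` (definitional). [folklore] -/
theorem weilCertDeflM80X_base : weilCertDeflM80X.base = weilCertDeflM80XBase := rfl

/-- The table of `weilCertDeflM80X` is `weilCertDeflM80XNu` (definitional). [folklore] -/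
theorem weilCertDeflM80X_nuTab : weilCertDeflM80X.nuTab = weilCertDeflM80XNu := rfl

/-- The augmented coefficient matrix `P_r + Σ μ ĉ ĉᵀ` of certificate M80X (penalties of M80P). [folklore] -/
def weilCertDeflM80XP (k l : ℕ) : ℚ := weilCertDeflM80XBase.prQ weilCertDeflM80XNu k l + rankOneQ weilCertDeflM80PR k l

/-- `weilCertDeflM80XP` is the augmented matrix of the certificate (definitional). [folklore] -/
theorem weilCertDeflM80XP_eq : weilCertDeflM80XP = fun k l ↦ weilCertDeflM80X.base.prQ weilCertDeflM80X.nuTab k l + rankOneQ weilCertDeflM80PR k l := rfl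

end Summit.RiemannHypothesis.RiemannHypothesis.Theorems.EvenWinsBeyondArch

end
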